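import Mathlib.Data.Nat.Choose.Basic
import Mathlib.Tactic
import Summits.CriticalPhenomena.PercolationContinuityZ3.Theorems.PercNearOneGluingNoHeavyLowerTailThetaBound
import HarnessLib

/-!
# Concavity of the pair-orientation bias `θ` and the difference step for the pair values

Support file for the Sahi / Conjecture-P programme of route `PercNearOneGluingNoHeavy`
(`--supports stmt-CriticalPhenomena-4575`, prover prim-l12-p5 gen 28; proof note
`prim-l12-p5/U-PROOF-g28.md` §6).  No definitions, no named facts, no sorries.  Sequel of `…ThetaBound`
(notation there): `y_b = C(n,b)`, `x_b = C(n,t-b)·[b ≤ t]`, `t + j = n`, `θ_b = (y_b - x_b)/(y_b + x_b)`,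
`v = 2b - t`, pair values `A = v² - j v θ`, `D_b = A_{b+1} - A_b = 4(v+1) - j[(v+2)θ_{b+1} - vθ_b]`.

* `cross_diff` : `(b+1)(b+j+1)(x_b y_{b+1} - x_{b+1} y_b) = J x_b y_b`, `J = j(n+1)`;
* `theta_concave` : `θ_{b+1} - θ_b ≥ θ_{b+2} - θ_{b+1}` (cleared of denominators it is `ThetaBound.theta_bound`
  at the middle point);
* `theta_chord` : `v θ_{b+1} ≤ (v+2) θ_b` (induction, from concavity; at the origin `θ_{b-1} = -θ_b`);
* `H_mono`, `D_step` : `(v+1)[(v+4)θ₂ - (v+2)θ₁] ≤ (v+3)[(v+2)θ₁ - vθ₀]`, hence `D_b ≥ 0 ⟹ D_{b+1} ≥ 0`: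
  the pair values `A` are valley-shaped (used in `…OneBlock`).
-/

namespace Summit.CriticalPhenomena.PercolationContinuityZ3.Theorems

namespace ThetaConcave

open ThetaBound

/-- Difference formula for `θ`: `θ_{b+1} - θ_b = 2 J x_b y_b / ((b+1)(b+j+1)(x_b+y_b)(x_{b+1}+y_{b+1}))`,
in the cross-multiplied form `(b+1)(b+j+1)(x_b y_{b+1} - x_{b+1} y_b) = J x_b y_b`. -/
theorem cross_diff (n j t b : ℕ) (ht : t + j = n) :
    (((b : ℝ) + 1) * ((b : ℝ) + j + 1)) *
      ((if b ≤ t then ((n.choose (t - b) : ℕ) : ℝ) else 0) * ((n.choose (b + 1) : ℕ) : ℝ) -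
        (if b + 1 ≤ t then ((n.choose (t - (b + 1)) : ℕ) : ℝ) else 0) * ((n.choose b : ℕ) : ℝ)) =
      ((j : ℝ) * ((n : ℝ) + 1)) *
        ((if b ≤ t then ((n.choose (t - b) : ℕ) : ℝ) else 0) * ((n.choose b : ℕ) : ℝ)) := by
  have hrx := rel_x n j t b ht
  have hry := rel_y n b
  have hn : ((n : ℝ)) = (t : ℝ) + j := by exact_mod_cast ht.symm
  set x0 : ℝ := (if b ≤ t then ((n.choose (t - b) : ℕ) : ℝ) else 0)
  set x1 : ℝ := (if b + 1 ≤ t then ((n.choose (t - (b + 1)) : ℕ) : ℝ) else 0)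
  set y0 : ℝ := ((n.choose b : ℕ) : ℝ)
  set y1 : ℝ := ((n.choose (b + 1) : ℕ) : ℝ)
  rw [hn]
  linear_combination (((b : ℝ) + j + 1) * x0) * hry - (((b : ℝ) + 1) * y0) * hrx +
    (x0 * y0 * ((b : ℝ) + 1 + j)) * hn

/-- **Concavity of `θ`** at three consecutive pairs `b, b+1, b+2` (middle value `v+2 = 2b+2-t ≥ 0`,
`b + 2 ≤ n`): `θ_{b+1} - θ_b ≥ θ_{b+2} - θ_{b+1}`.  Equivalent, after clearing denominators with the
recurrences, to `theta_bound` at the middle point. -/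
theorem theta_concave (n j t : ℕ) (ht : t + j = n) (hj : 1 ≤ j) (b : ℕ) (hb : t ≤ 2 * b + 2)
    (hbn : b + 2 ≤ n) :
    (((n.choose (b + 2) : ℕ) : ℝ) - (if b + 2 ≤ t then ((n.choose (t - (b + 2)) : ℕ) : ℝ) else 0)) /
        (((n.choose (b + 2) : ℕ) : ℝ) + (if b + 2 ≤ t then ((n.choose (t - (b + 2)) : ℕ) : ℝ) else 0)) -
      (((n.choose (b + 1) : ℕ) : ℝ) - (if b + 1 ≤ t then ((n.choose (t - (b + 1)) : ℕ) : ℝ) else 0)) /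
        (((n.choose (b + 1) : ℕ) : ℝ) + (if b + 1 ≤ t then ((n.choose (t - (b + 1)) : ℕ) : ℝ) else 0)) ≤
    (((n.choose (b + 1) : ℕ) : ℝ) - (if b + 1 ≤ t then ((n.choose (t - (b + 1)) : ℕ) : ℝ) else 0)) /
        (((n.choose (b + 1) : ℕ) : ℝ) + (if b + 1 ≤ t then ((n.choose (t - (b + 1)) : ℕ) : ℝ) else 0)) -
      (((n.choose b : ℕ) : ℝ) - (if b ≤ t then ((n.choose (t - b) : ℕ) : ℝ) else 0)) /
        (((n.choose b : ℕ) : ℝ) + (if b ≤ t then ((n.choose (t - b) : ℕ) : ℝ) else 0)) := by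
  set x0 : ℝ := (if b ≤ t then ((n.choose (t - b) : ℕ) : ℝ) else 0) with hx0
  set x1 : ℝ := (if b + 1 ≤ t then ((n.choose (t - (b + 1)) : ℕ) : ℝ) else 0) with hx1
  set x2 : ℝ := (if b + 2 ≤ t then ((n.choose (t - (b + 2)) : ℕ) : ℝ) else 0) with hx2
  set y0 : ℝ := ((n.choose b : ℕ) : ℝ) with hy0
  set y1 : ℝ := ((n.choose (b + 1) : ℕ) : ℝ) with hy1
  set y2 : ℝ := ((n.choose (b + 2) : ℕ) : ℝ) with hy2
  have hx0nn : 0 ≤ x0 := by rw [hx0]; split_ifs <;> positivity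
  have hx1nn : 0 ≤ x1 := by rw [hx1]; split_ifs <;> positivity
  have hx2nn : 0 ≤ x2 := by rw [hx2]; split_ifs <;> positivity
  have hy0 : 0 < y0 := by rw [hy0]; exact_mod_cast Nat.choose_pos (by omega)
  have hy1 : 0 < y1 := by rw [hy1]; exact_mod_cast Nat.choose_pos (by omega)
  have hy2 : 0 < y2 := by rw [hy2]; exact_mod_cast Nat.choose_pos (by omega)
  have hn : ((n : ℝ)) = (t : ℝ) + j := by exact_mod_cast ht.symm
  -- recurrences
  have hrx0 : x1 * ((b : ℝ) + j + 1) = x0 * ((t : ℝ) - b) := rel_x n j t b ht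
  have hrx1 : x2 * (((b : ℝ) + 1) + j + 1) = x1 * ((t : ℝ) - ((b : ℝ) + 1)) := by
    have := rel_x n j t (b + 1) ht
    push_cast at this
    exact this
  have hry0 : y1 * ((b : ℝ) + 1) = y0 * ((n : ℝ) - b) := rel_y n b
  have hry1 : y2 * (((b : ℝ) + 1) + 1) = y1 * ((n : ℝ) - ((b : ℝ) + 1)) := by
    have := rel_y n (b + 1)
    push_cast at this
    exact this
  -- cross differences
  have h1 : (((b : ℝ) + 1) * ((b : ℝ) + j + 1)) * (x0 * y1 - x1 * y0) =
      ((j : ℝ) * ((n : ℝ) + 1)) * (x0 * y0) := cross_diff n j t b ht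
  have h2 : ((((b : ℝ) + 1) + 1) * (((b : ℝ) + 1) + j + 1)) * (x1 * y2 - x2 * y1) =
      ((j : ℝ) * ((n : ℝ) + 1)) * (x1 * y1) := by
    have := cross_diff n j t (b + 1) ht
    push_cast at this
    exact this
  -- the bound at the middle point b+1 (v+2 = 2b+2-t ≥ 0)
  have hbound : x1 * ((j : ℝ) * ((n : ℝ) + 1) + (2 * ((b : ℝ) + 1) - t)) ≤
      y1 * ((j : ℝ) * ((n : ℝ) + 1) - (2 * ((b : ℝ) + 1) - t)) := by
    have := theta_bound n j t ht hj (b + 1) (by omega) (by omega)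
    push_cast at this
    exact this
  -- (b+2)(b+j+2)(x2+y2) - a(a+j)(x0+y0) = y1 (J-v-2) - x1 (J+v+2) ≥ 0, a = t - b
  have h6 : ((t : ℝ) - b) * (((t : ℝ) - b) + j) * (x0 + y0) ≤
      (((b : ℝ) + 2) * ((b : ℝ) + j + 2)) * (x2 + y2) := by
    have e4 : (((b : ℝ) + 2) * ((b : ℝ) + j + 2)) * (x2 + y2) =
        ((b : ℝ) + 2) * (((t : ℝ) - b) - 1) * x1 + ((b : ℝ) + j + 2) * (((t : ℝ) - b) + j - 1) * y1 := by
      rw [hn] at hry1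
      linear_combination ((b : ℝ) + 2) * hrx1 + ((b : ℝ) + j + 2) * hry1
    have e5 : ((t : ℝ) - b) * (((t : ℝ) - b) + j) * (x0 + y0) =
        (((t : ℝ) - b) + j) * ((b : ℝ) + j + 1) * x1 + ((t : ℝ) - b) * ((b : ℝ) + 1) * y1 := by
      rw [hn] at hry0
      linear_combination (-(((t : ℝ) - b) + j)) * hrx0 - ((t : ℝ) - b) * hry0
    rw [e4, e5]
    rw [hn] at hbound
    linarith [hbound]
  -- clear denominators
  have hd0 : 0 < y0 + x0 := by linarith
  have hd1 : 0 < y1 + x1 := by linarith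
  have hd2 : 0 < y2 + x2 := by linarith
  rw [div_sub_div _ _ hd2.ne' hd1.ne', div_sub_div _ _ hd1.ne' hd0.ne', div_le_div_iff₀ (mul_pos hd2 hd1) (mul_pos hd1 hd0)]
  -- ((y2-x2)(y1+x1) - (y2+x2)(y1-x1)) (y1+x1)(y0+x0) ≤ ((y1-x1)(y0+x0) - (y1+x1)(y0-x0)) (y2+x2)(y1+x1)
  -- i.e. 2(x1 y2 - x2 y1)(y1+x1)(y0+x0) ≤ 2(x0 y1 - x1 y0)(y2+x2)(y1+x1)
  have hP : (0 : ℝ) < ((b : ℝ) + 1) * ((b : ℝ) + j + 1) * (((b : ℝ) + 2) * ((b : ℝ) + j + 2)) := by positivity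
  have key : (((y2 - x2) * (y1 + x1) - (y2 + x2) * (y1 - x1)) * ((y1 + x1) * (y0 + x0))) *
      (((b : ℝ) + 1) * ((b : ℝ) + j + 1) * (((b : ℝ) + 2) * ((b : ℝ) + j + 2))) ≤
      (((y1 - x1) * (y0 + x0) - (y1 + x1) * (y0 - x0)) * ((y2 + x2) * (y1 + x1))) *
      (((b : ℝ) + 1) * ((b : ℝ) + j + 1) * (((b : ℝ) + 2) * ((b : ℝ) + j + 2))) := by
    have eL : (((y2 - x2) * (y1 + x1) - (y2 + x2) * (y1 - x1)) * ((y1 + x1) * (y0 + x0))) *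
        (((b : ℝ) + 1) * ((b : ℝ) + j + 1) * (((b : ℝ) + 2) * ((b : ℝ) + j + 2))) =
        2 * ((j : ℝ) * ((n : ℝ) + 1)) * (((t : ℝ) - b) * (((t : ℝ) - b) + j) * (x0 * y0)) *
          ((y1 + x1) * (y0 + x0)) := by
      have h3 : (((b : ℝ) + 1) * ((b : ℝ) + j + 1)) * (x1 * y1) = ((t : ℝ) - b) * (((t : ℝ) - b) + j) * (x0 * y0) := by
        rw [hn] at hry0
        linear_combination (y1 * ((b : ℝ) + 1)) * hrx0 + (x0 * ((t : ℝ) - b)) * hry0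
      have h2' : (((b : ℝ) + 2) * ((b : ℝ) + j + 2)) * (x1 * y2 - x2 * y1) =
          ((j : ℝ) * ((n : ℝ) + 1)) * (x1 * y1) := by
        have e : (((b : ℝ) + 2) * ((b : ℝ) + j + 2)) = ((((b : ℝ) + 1) + 1) * (((b : ℝ) + 1) + j + 1)) := by ring
        rw [e]
        exact h2
      linear_combination (2 * ((y1 + x1) * (y0 + x0)) * (((b : ℝ) + 1) * ((b : ℝ) + j + 1))) * h2' +
        (2 * ((j : ℝ) * ((n : ℝ) + 1)) * ((y1 + x1) * (y0 + x0))) * h3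
    have eR : (((y1 - x1) * (y0 + x0) - (y1 + x1) * (y0 - x0)) * ((y2 + x2) * (y1 + x1))) *
        (((b : ℝ) + 1) * ((b : ℝ) + j + 1) * (((b : ℝ) + 2) * ((b : ℝ) + j + 2))) =
        2 * ((j : ℝ) * ((n : ℝ) + 1)) * (x0 * y0) * ((y1 + x1) *
          ((((b : ℝ) + 2) * ((b : ℝ) + j + 2)) * (x2 + y2))) := by
      linear_combination (2 * ((y2 + x2) * (y1 + x1)) * (((b : ℝ) + 2) * ((b : ℝ) + j + 2))) * h1
    rw [eL, eR]
    have hc : 0 ≤ 2 * ((j : ℝ) * ((n : ℝ) + 1)) * (x0 * y0) * (y1 + x1) := by positivity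
    have hm := mul_le_mul_of_nonneg_left h6 hc
    have e6 : 2 * ((j : ℝ) * ((n : ℝ) + 1)) * (((t : ℝ) - b) * (((t : ℝ) - b) + j) * (x0 * y0)) *
        ((y1 + x1) * (y0 + x0)) =
        2 * ((j : ℝ) * ((n : ℝ) + 1)) * (x0 * y0) * (y1 + x1) * (((t : ℝ) - b) * (((t : ℝ) - b) + j) * (x0 + y0)) := by
      ring
    have e7 : 2 * ((j : ℝ) * ((n : ℝ) + 1)) * (x0 * y0) * ((y1 + x1) *
        ((((b : ℝ) + 2) * ((b : ℝ) + j + 2)) * (x2 + y2))) =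
        2 * ((j : ℝ) * ((n : ℝ) + 1)) * (x0 * y0) * (y1 + x1) * ((((b : ℝ) + 2) * ((b : ℝ) + j + 2)) * (x2 + y2)) := by
      ring
    rw [e6, e7]
    exact hm
  exact le_of_mul_le_mul_right key hP

/-- **Chord property** `v·θ_{b+1} ≤ (v+2)·θ_b` (`v = 2b - t ≥ 0`, `b + 1 ≤ n`): `θ(v)/v` is non-increasing.
By induction on `b` from concavity (at the origin: `θ_{b-1} = -θ_b` when `2b = t+1`). -/
theorem theta_chord (n j t : ℕ) (ht : t + j = n) (hj : 1 ≤ j) :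
    ∀ b, t ≤ 2 * b → b + 1 ≤ n →
      (2 * (b : ℝ) - t) *
          ((((n.choose (b + 1) : ℕ) : ℝ) - (if b + 1 ≤ t then ((n.choose (t - (b + 1)) : ℕ) : ℝ) else 0)) /
            (((n.choose (b + 1) : ℕ) : ℝ) + (if b + 1 ≤ t then ((n.choose (t - (b + 1)) : ℕ) : ℝ) else 0))) ≤
        (2 * (b : ℝ) - t + 2) *
          ((((n.choose b : ℕ) : ℝ) - (if b ≤ t then ((n.choose (t - b) : ℕ) : ℝ) else 0)) /
            (((n.choose b : ℕ) : ℝ) + (if b ≤ t then ((n.choose (t - b) : ℕ) : ℝ) else 0))) := by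
  intro b
  induction b with
  | zero =>
    intro hb hbn
    have ht0 : t = 0 := by omega
    subst ht0
    simp
  | succ b ih =>
    intro hb hbn
    rcases Nat.lt_or_ge (2 * b) t with hlt | hge
    · rcases Nat.lt_or_ge (2 * b + 1) t with hlt2 | hge2
      · -- 2(b+1) = t : θ_{b+1} = 0, v = 0
        have htb : t = 2 * b + 2 := by omega
        have ev : (2 * (((b + 1 : ℕ)) : ℝ) - t) = 0 := by rw [htb]; push_cast; ring
        rw [ev, zero_mul]
        rw [if_pos (by omega)]
        have e : t - (b + 1) = b + 1 := by omega
        rw [e]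
        simp
      · -- 2(b+1) = t+1 : v = 1, θ_{b+2} ≤ 3 θ_{b+1} from concavity at (b, b+1, b+2) with θ_b = -θ_{b+1}
        have htb : t = 2 * b + 1 := by omega
        have ev : (2 * (((b + 1 : ℕ)) : ℝ) - t) = 1 := by rw [htb]; push_cast; ring
        rw [ev, one_mul]
        have hconc := theta_concave n j t ht hj b (by omega) (by omega)
        -- θ_b = -θ_{b+1}: x_b = C(n,b+1) = y_{b+1}, y_b = C(n,b) = x_{b+1}
        have e1 : t - b = b + 1 := by omega
        have e2 : t - (b + 1) = b := by omega
        have e3 : b + 1 + 1 = b + 2 := by omega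
        rw [if_pos (by omega : b ≤ t), if_pos (by omega : b + 1 ≤ t), e1, e2] at hconc
        rw [if_pos (by omega : b + 1 ≤ t), e2, e3]
        have hy0 : 0 < ((n.choose b : ℕ) : ℝ) := by exact_mod_cast Nat.choose_pos (by omega)
        have hy1 : 0 < ((n.choose (b + 1) : ℕ) : ℝ) := by exact_mod_cast Nat.choose_pos (by omega)
        have hneg : (((n.choose b : ℕ) : ℝ) - ((n.choose (b + 1) : ℕ) : ℝ)) /
            (((n.choose b : ℕ) : ℝ) + ((n.choose (b + 1) : ℕ) : ℝ)) =
            -((((n.choose (b + 1) : ℕ) : ℝ) - ((n.choose b : ℕ) : ℝ)) /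
              (((n.choose (b + 1) : ℕ) : ℝ) + ((n.choose b : ℕ) : ℝ))) := by
          rw [add_comm ((n.choose b : ℕ) : ℝ), ← neg_div]
          ring
        rw [hneg] at hconc
        linarith
    · -- induction step: from chord at b and concavity at (b, b+1, b+2)
      have ih' := ih hge (by omega)
      have hconc := theta_concave n j t ht hj b (by omega) (by omega)
      have e3 : b + 1 + 1 = b + 2 := by omega
      rw [e3]
      have ev : (2 * (((b + 1 : ℕ)) : ℝ) - t) = (2 * (b : ℝ) - t) + 2 := by push_cast; ring
      rw [ev]
      have hvnn : 0 ≤ 2 * (b : ℝ) - t := by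
        have : ((t : ℝ)) ≤ 2 * (b : ℝ) := by exact_mod_cast (show (t : ℕ) ≤ 2 * b by omega)
        linarith
      set θ0 := (((n.choose b : ℕ) : ℝ) - (if b ≤ t then ((n.choose (t - b) : ℕ) : ℝ) else 0)) /
            (((n.choose b : ℕ) : ℝ) + (if b ≤ t then ((n.choose (t - b) : ℕ) : ℝ) else 0))
      set θ1 := ((((n.choose (b + 1) : ℕ) : ℝ) - (if b + 1 ≤ t then ((n.choose (t - (b + 1)) : ℕ) : ℝ) else 0)) /
            (((n.choose (b + 1) : ℕ) : ℝ) + (if b + 1 ≤ t then ((n.choose (t - (b + 1)) : ℕ) : ℝ) else 0)))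
      set θ2 := ((((n.choose (b + 2) : ℕ) : ℝ) - (if b + 2 ≤ t then ((n.choose (t - (b + 2)) : ℕ) : ℝ) else 0)) /
            (((n.choose (b + 2) : ℕ) : ℝ) + (if b + 2 ≤ t then ((n.choose (t - (b + 2)) : ℕ) : ℝ) else 0)))
      -- (v+2) θ2 ≤ (v+2)(2θ1 - θ0) ≤ 2(v+2)θ1 - v θ1 = (v+4) θ1
      have hm := mul_le_mul_of_nonneg_left hconc (by linarith : (0:ℝ) ≤ 2 * (b : ℝ) - t + 2)
      have e4 : (2 * (b : ℝ) - t + 2) * (θ2 - θ1) = (2 * (b : ℝ) - t + 2) * θ2 - (2 * (b : ℝ) - t + 2) * θ1 := by ring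
      have e5 : (2 * (b : ℝ) - t + 2) * (θ1 - θ0) = (2 * (b : ℝ) - t + 2) * θ1 - (2 * (b : ℝ) - t + 2) * θ0 := by ring
      rw [e4, e5] at hm
      linarith

/-- **Monotonicity of the normalised difference** `H_b = [(v+2)θ_{b+1} - vθ_b]/(v+1)`, cross-multiplied:
`(v+1)[(v+4)θ_{b+2} - (v+2)θ_{b+1}] ≤ (v+3)[(v+2)θ_{b+1} - vθ_b]` for `v = 2b - t ≥ 0`, `b + 2 ≤ n`. -/
theorem H_mono (n j t : ℕ) (ht : t + j = n) (hj : 1 ≤ j) (b : ℕ) (hb : t ≤ 2 * b) (hbn : b + 2 ≤ n) :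
    (2 * (b : ℝ) - t + 1) *
        ((2 * (b : ℝ) - t + 4) *
            ((((n.choose (b + 2) : ℕ) : ℝ) - (if b + 2 ≤ t then ((n.choose (t - (b + 2)) : ℕ) : ℝ) else 0)) /
              (((n.choose (b + 2) : ℕ) : ℝ) + (if b + 2 ≤ t then ((n.choose (t - (b + 2)) : ℕ) : ℝ) else 0))) -
          (2 * (b : ℝ) - t + 2) *
            ((((n.choose (b + 1) : ℕ) : ℝ) - (if b + 1 ≤ t then ((n.choose (t - (b + 1)) : ℕ) : ℝ) else 0)) /
              (((n.choose (b + 1) : ℕ) : ℝ) + (if b + 1 ≤ t then ((n.choose (t - (b + 1)) : ℕ) : ℝ) else 0)))) ≤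
      (2 * (b : ℝ) - t + 3) *
        ((2 * (b : ℝ) - t + 2) *
            ((((n.choose (b + 1) : ℕ) : ℝ) - (if b + 1 ≤ t then ((n.choose (t - (b + 1)) : ℕ) : ℝ) else 0)) /
              (((n.choose (b + 1) : ℕ) : ℝ) + (if b + 1 ≤ t then ((n.choose (t - (b + 1)) : ℕ) : ℝ) else 0))) -
          (2 * (b : ℝ) - t) *
            ((((n.choose b : ℕ) : ℝ) - (if b ≤ t then ((n.choose (t - b) : ℕ) : ℝ) else 0)) /
              (((n.choose b : ℕ) : ℝ) + (if b ≤ t then ((n.choose (t - b) : ℕ) : ℝ) else 0)))) := by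
  have hconc := theta_concave n j t ht hj b (by omega) hbn
  have hchord := theta_chord n j t ht hj b hb (by omega)
  have hvnn : 0 ≤ 2 * (b : ℝ) - t := by
    have : ((t : ℝ)) ≤ 2 * (b : ℝ) := by exact_mod_cast hb
    linarith
  set v := 2 * (b : ℝ) - t
  set θ0 := (((n.choose b : ℕ) : ℝ) - (if b ≤ t then ((n.choose (t - b) : ℕ) : ℝ) else 0)) /
        (((n.choose b : ℕ) : ℝ) + (if b ≤ t then ((n.choose (t - b) : ℕ) : ℝ) else 0))
  set θ1 := ((((n.choose (b + 1) : ℕ) : ℝ) - (if b + 1 ≤ t then ((n.choose (t - (b + 1)) : ℕ) : ℝ) else 0)) /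
        (((n.choose (b + 1) : ℕ) : ℝ) + (if b + 1 ≤ t then ((n.choose (t - (b + 1)) : ℕ) : ℝ) else 0)))
  set θ2 := ((((n.choose (b + 2) : ℕ) : ℝ) - (if b + 2 ≤ t then ((n.choose (t - (b + 2)) : ℕ) : ℝ) else 0)) /
        (((n.choose (b + 2) : ℕ) : ℝ) + (if b + 2 ≤ t then ((n.choose (t - (b + 2)) : ℕ) : ℝ) else 0)))
  -- (v+1)(v+4) θ2 ≤ (v+1)(v+4)(2θ1 - θ0); then the claim reduces to 2[(v+2)θ0 - vθ1] ≥ 0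
  have hm := mul_le_mul_of_nonneg_left hconc (by positivity : (0:ℝ) ≤ (v + 1) * (v + 4))
  have e4 : (v + 1) * (v + 4) * (θ2 - θ1) = (v + 1) * (v + 4) * θ2 - (v + 1) * (v + 4) * θ1 := by ring
  have e5 : (v + 1) * (v + 4) * (θ1 - θ0) = (v + 1) * (v + 4) * θ1 - (v + 1) * (v + 4) * θ0 := by ring
  rw [e4, e5] at hm
  linarith

/-- **Difference step.**  With `D_b = 4(v+1) - j[(v+2)θ_{b+1} - vθ_b]` (`= A_{b+1} - A_b` for the pair values
`A = v² - jvθ`): `D_b ≥ 0 ⟹ D_{b+1} ≥ 0` (`v = 2b - t ≥ 0`, `b + 2 ≤ n`).  Hence `A` is valley-shaped. -/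
theorem D_step (n j t : ℕ) (ht : t + j = n) (hj : 1 ≤ j) (b : ℕ) (hb : t ≤ 2 * b) (hbn : b + 2 ≤ n)
    (hD : 0 ≤ 4 * (2 * (b : ℝ) - t + 1) - (j : ℝ) *
        ((2 * (b : ℝ) - t + 2) *
            ((((n.choose (b + 1) : ℕ) : ℝ) - (if b + 1 ≤ t then ((n.choose (t - (b + 1)) : ℕ) : ℝ) else 0)) /
              (((n.choose (b + 1) : ℕ) : ℝ) + (if b + 1 ≤ t then ((n.choose (t - (b + 1)) : ℕ) : ℝ) else 0))) -
          (2 * (b : ℝ) - t) *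
            ((((n.choose b : ℕ) : ℝ) - (if b ≤ t then ((n.choose (t - b) : ℕ) : ℝ) else 0)) /
              (((n.choose b : ℕ) : ℝ) + (if b ≤ t then ((n.choose (t - b) : ℕ) : ℝ) else 0))))) :
    0 ≤ 4 * (2 * (b : ℝ) - t + 3) - (j : ℝ) *
        ((2 * (b : ℝ) - t + 4) *
            ((((n.choose (b + 2) : ℕ) : ℝ) - (if b + 2 ≤ t then ((n.choose (t - (b + 2)) : ℕ) : ℝ) else 0)) /
              (((n.choose (b + 2) : ℕ) : ℝ) + (if b + 2 ≤ t then ((n.choose (t - (b + 2)) : ℕ) : ℝ) else 0))) -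
          (2 * (b : ℝ) - t + 2) *
            ((((n.choose (b + 1) : ℕ) : ℝ) - (if b + 1 ≤ t then ((n.choose (t - (b + 1)) : ℕ) : ℝ) else 0)) /
              (((n.choose (b + 1) : ℕ) : ℝ) + (if b + 1 ≤ t then ((n.choose (t - (b + 1)) : ℕ) : ℝ) else 0)))) := by
  have hH := H_mono n j t ht hj b hb hbn
  have hvnn : 0 ≤ 2 * (b : ℝ) - t := by
    have : ((t : ℝ)) ≤ 2 * (b : ℝ) := by exact_mod_cast hb
    linarith
  have hjnn : (0 : ℝ) ≤ j := by positivity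
  set v := 2 * (b : ℝ) - t
  set θ0 := (((n.choose b : ℕ) : ℝ) - (if b ≤ t then ((n.choose (t - b) : ℕ) : ℝ) else 0)) /
        (((n.choose b : ℕ) : ℝ) + (if b ≤ t then ((n.choose (t - b) : ℕ) : ℝ) else 0))
  set θ1 := ((((n.choose (b + 1) : ℕ) : ℝ) - (if b + 1 ≤ t then ((n.choose (t - (b + 1)) : ℕ) : ℝ) else 0)) /
        (((n.choose (b + 1) : ℕ) : ℝ) + (if b + 1 ≤ t then ((n.choose (t - (b + 1)) : ℕ) : ℝ) else 0)))
  set θ2 := ((((n.choose (b + 2) : ℕ) : ℝ) - (if b + 2 ≤ t then ((n.choose (t - (b + 2)) : ℕ) : ℝ) else 0)) /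
        (((n.choose (b + 2) : ℕ) : ℝ) + (if b + 2 ≤ t then ((n.choose (t - (b + 2)) : ℕ) : ℝ) else 0)))
  -- (v+1) · j[(v+4)θ2 - (v+2)θ1] ≤ (v+3) · j[(v+2)θ1 - vθ0] ≤ (v+3) · 4(v+1)
  have h1 : (v + 1) * ((j : ℝ) * ((v + 4) * θ2 - (v + 2) * θ1)) ≤ (v + 3) * ((j : ℝ) * ((v + 2) * θ1 - v * θ0)) := by
    have hm := mul_le_mul_of_nonneg_left hH hjnn
    have e1 : (j : ℝ) * ((v + 1) * ((v + 4) * θ2 - (v + 2) * θ1)) = (v + 1) * ((j : ℝ) * ((v + 4) * θ2 - (v + 2) * θ1)) := by ring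
    have e2 : (j : ℝ) * ((v + 3) * ((v + 2) * θ1 - v * θ0)) = (v + 3) * ((j : ℝ) * ((v + 2) * θ1 - v * θ0)) := by ring
    rw [e1, e2] at hm
    exact hm
  have h2 : (v + 3) * ((j : ℝ) * ((v + 2) * θ1 - v * θ0)) ≤ (v + 3) * (4 * (v + 1)) := by
    apply mul_le_mul_of_nonneg_left _ (by linarith)
    linarith
  have hv1 : 0 < v + 1 := by linarith
  have h3 : (v + 1) * ((j : ℝ) * ((v + 4) * θ2 - (v + 2) * θ1)) ≤ (v + 1) * (4 * (v + 3)) := by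
    have e : (v + 1) * (4 * (v + 3)) = (v + 3) * (4 * (v + 1)) := by ring
    rw [e]
    exact le_trans h1 h2
  have := le_of_mul_le_mul_left h3 hv1
  linarith

end ThetaConcave

end Summit.CriticalPhenomena.PercolationContinuityZ3.Theorems
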